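import Summits.AtomisticToContinuum.BoseEinsteinCondensation.Theorems.BECRieszReverseHolderCoarseGrainedReverseHolderReduction
import Summits.AtomisticToContinuum.BoseEinsteinCondensation.Theorems.BECRieszReverseHolderCoarseRH2Toolkit
import Literature.MathematicalPhysics.QuantumManyBody.GroundState
import Literature.MathematicalPhysics.QuantumManyBody.SwapPurity
import HarnessLib

/-!
# Route `BECRieszReverseHolder`, crux `CoarseGrainedReverseHolder` (stmt-AtomisticToContinuum-12840):
# resolution-free sufficient conditions on non-negative ground states

Supports (does not close) stmt-AtomisticToContinuum-12840 (line `registered`, lead c6). By the landed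
first layer (`coarseGrainedReverseHolder_of_groundStates`, and its converse in
`…GroundStateEquivalence.lean`) the crux is EQUIVALENT to a bound, uniform in `N = n + 1`, on the
coarse-grained reverse-Hölder functional
`F_{n,ℓ}(Φ) = m³ ∫ dX̂ Σ_Q (∫_Q Φ(y,X̂)² dy)² / ∫ Φ(y,X̂)² dy` of non-negative GROUND STATES `Φ`, at
every fixed resolution `ℓ > 0` (`m = ⌊L/ℓ⌋`, cubes `Q` of side `L/m`). Writing `M(X̂) = ∫ Φ(·,X̂)²`
for the slice mass and `p_X̂ = Φ(·,X̂)²/M(X̂)` for the normalised conditional density of the tagged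
particle given the environment `X̂`, `F_{n,ℓ} = E_μ̂[m³ Σ_Q p_Q²]` (`μ̂ = M dX̂`).

This file records the two RESOLUTION-FREE forms a mechanism acting on exact ground states would
naturally deliver, and checks that each implies the crux at every resolution at once:

* `groundStateBound_of_sliceSqBound` / `coarseGrainedReverseHolder_of_sliceSqBound` — the slice
  `L⁴/L²` bound `L³ ∫ dX̂ (∫ Φ(y,X̂)⁴ dy) / M(X̂) ≤ C`, i.e. `E_μ̂[L³ ‖p_X̂‖₂²] ≤ C`, implies
  `F_{n,ℓ} ≤ C` for EVERY `ℓ > 0` (Cauchy–Schwarz in each cube and `m³ |Q| = L³`,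
  `CoarseRH2.natCast_pow_mul_sum_sq_setLIntegral_subCell_le`); the small-`ℓ` end of the crux's
  `∀ ℓ > 0` is its pointwise `L²` form, and nothing is lost in the constant.
* `sliceSqBound_of_essSupBound` / `coarseGrainedReverseHolder_of_essSupBound` — the maximal-slice
  bound `∫ dX̂ L³ ess sup_y Φ(y,X̂)² ≤ K` (replacing the `y`-average of `Φ²` by its `y`-supremum costs
  at most a factor `K`, against `∫ dX̂ ∫ dy Φ² = 1`) implies the slice `L⁴/L²` bound with `C = K`
  (`∫ Φ⁴ ≤ ess sup Φ² · ∫ Φ²`).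

Both hypotheses are statements about exact non-negative ground states only; both are (like the crux)
at least as strong as flat-mode BEC in the thermodynamic limit (`…Consequences.lean`), so neither is
claimed here — they are the typed targets, not results.
-/

noncomputable section

open MeasureTheory Filter Matrix
open scoped ENNReal NNReal BigOperators

namespace Summit.AtomisticToContinuum.BoseEinsteinCondensation.Theorems.CoarseGrainedReverseHolder

open Literature.MathematicalPhysics.QuantumManyBody
open Summit.AtomisticToContinuum.BoseEinsteinCondensation.Theses.BECRieszReverseHolder

namespace SufficientConditions

/-- **Coarse second moment of a slice ≤ its fine second moment** (pointwise in the environment):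
for `0 < L`, any `m` and any measurable slice `F : ℝ³ → ℂ`,
`m³ Σ_k (∫_{Q_k} |F|²)² / M ≤ L³ (∫ |F|⁴) / M` for every `M` (the cubes `Q_k` of side `L/m` of the
crux; Cauchy–Schwarz in each cube, `m³|Q_k| = L³`, `Σ_k ∫_{Q_k} ≤ ∫`; `m = 0` makes the left side `0`). -/
theorem coarse_div_le_sliceSq_div {L : ℝ} (hL : 0 < L) (m : ℕ) {F : BoseGas.Space → ℂ}
    (hF : Measurable F) (M : ℝ≥0∞) :
    (m : ℝ≥0∞) ^ 3 * ((∑ k : Fin 3 → Fin m,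
        (∫⁻ y in {y : EuclideanSpace ℝ (Fin 3) |
            ∀ i, y i ∈ Set.Ico ((k i : ℝ) * (L / m)) (((k i : ℝ) + 1) * (L / m))},
          (‖F y‖₊ : ℝ≥0∞) ^ 2) ^ 2) / M) ≤
      ENNReal.ofReal L ^ 3 * ((∫⁻ y, (‖F y‖₊ : ℝ≥0∞) ^ 4) / M) := by
  rcases Nat.eq_zero_or_pos m with rfl | hm
  · simp
  have hw : AEMeasurable (fun y => (‖F y‖₊ : ℝ≥0∞) ^ 2) volume :=
    (hF.nnnorm.coe_nnreal_ennreal.pow_const 2).aemeasurable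
  have h := CoarseRH2.natCast_pow_mul_sum_sq_setLIntegral_subCell_le hL hm hw
  simp only [CoarseRH2.setOf_forall_mem_Ico_eq_subCell]
  rw [← mul_div_assoc, ← mul_div_assoc]
  refine ENNReal.div_le_div_right (h.trans ?_) M
  have hint : ∫⁻ y in BoseGas.cell L, ((‖F y‖₊ : ℝ≥0∞) ^ 2) ^ 2 ≤ ∫⁻ y, (‖F y‖₊ : ℝ≥0∞) ^ 4 :=
    calc ∫⁻ y in BoseGas.cell L, ((‖F y‖₊ : ℝ≥0∞) ^ 2) ^ 2
        ≤ ∫⁻ y, ((‖F y‖₊ : ℝ≥0∞) ^ 2) ^ 2 := setLIntegral_le_lintegral _ _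
      _ = ∫⁻ y, (‖F y‖₊ : ℝ≥0∞) ^ 4 := by
          refine lintegral_congr fun y => ?_
          rw [← pow_mul]
  exact mul_le_mul' le_rfl hint

/-- **`∫ |F|⁴ ≤ (ess sup |F|²) · ∫ |F|²`** for a measurable slice. -/
theorem lintegral_pow_four_le_essSup_mul {F : BoseGas.Space → ℂ} (hF : Measurable F) :
    ∫⁻ y, (‖F y‖₊ : ℝ≥0∞) ^ 4 ≤
      essSup (fun y => (‖F y‖₊ : ℝ≥0∞) ^ 2) volume * ∫⁻ y, (‖F y‖₊ : ℝ≥0∞) ^ 2 := by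
  have _hm : Measurable fun y => (‖F y‖₊ : ℝ≥0∞) ^ 2 := hF.nnnorm.coe_nnreal_ennreal.pow_const 2
  rw [← lintegral_const_mul'' _ _hm.aemeasurable]
  refine lintegral_mono_ae ?_
  filter_upwards [ENNReal.ae_le_essSup fun y => (‖F y‖₊ : ℝ≥0∞) ^ 2] with y hy
  calc (‖F y‖₊ : ℝ≥0∞) ^ 4 = (‖F y‖₊ : ℝ≥0∞) ^ 2 * (‖F y‖₊ : ℝ≥0∞) ^ 2 := by rw [← pow_add]
    _ ≤ essSup (fun y => (‖F y‖₊ : ℝ≥0∞) ^ 2) volume * (‖F y‖₊ : ℝ≥0∞) ^ 2 := by gcongr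

end SufficientConditions

open SufficientConditions

/-- **The slice `L⁴/L²` bound implies the ground-state bound at every resolution.** If for every
admissible `v` and all small `ρ` there is `C` such that, eventually in `n`, every non-negative ground
state `Φ` of `n + 1` bosons in the Dirichlet box of side `L = ((n+1)/ρ)^{1/3}` satisfies
`L³ ∫ dX̂ (∫ Φ(y,X̂)⁴ dy) / (∫ Φ(y,X̂)² dy) ≤ C` (`= E_μ̂[L³ ‖p_X̂‖₂²]`, the resolution-free second
moment of the conditional one-body density), then for EVERY `ℓ > 0` the coarse-grained functional of
the crux obeys `F_{n,ℓ}(Φ) ≤ C` on the same ground states (Cauchy–Schwarz cube by cube,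
`coarse_div_le_sliceSq_div`, integrated in `X̂`). -/
theorem groundStateBound_of_sliceSqBound : (∀ v : ℝ → ENNReal, BoseGas.IsRepulsiveFiniteRange v → ∃ ρ₀ : ℝ, 0 < ρ₀ ∧ ∀ ρ : ℝ, 0 < ρ → ρ < ρ₀ → ∃ C : ℝ, ∀ᶠ n : ℕ in Filter.atTop, ∀ Φ : BoseGas.Config (n + 1) → ℂ, BoseGas.IsGroundState v (BoseGas.sideLength ρ (n + 1)) Φ → (∀ X, Φ X = (‖Φ X‖ : ℂ)) → ENNReal.ofReal (BoseGas.sideLength ρ (n + 1)) ^ 3 * ∫⁻ X : Fin n → EuclideanSpace ℝ (Fin 3), (∫⁻ y, (‖Φ (Matrix.vecCons y X)‖₊ : ENNReal) ^ 4) / (∫⁻ y, (‖Φ (Matrix.vecCons y X)‖₊ : ENNReal) ^ 2) ≤ ENNReal.ofReal C) → ∀ v : ℝ → ENNReal, BoseGas.IsRepulsiveFiniteRange v → ∃ ρ₀ : ℝ, 0 < ρ₀ ∧ ∀ ρ : ℝ, 0 < ρ → ρ < ρ₀ → ∀ ℓ : ℝ, 0 < ℓ → ∃ C : ℝ, ∀ᶠ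 n : ℕ in Filter.atTop, ∀ Φ : BoseGas.Config (n + 1) → ℂ, BoseGas.IsGroundState v (BoseGas.sideLength ρ (n + 1)) Φ → (∀ X, Φ X = (‖Φ X‖ : ℂ)) → let L := BoseGas.sideLength ρ (n + 1); let m := ⌊L / ℓ⌋₊; (m : ENNReal) ^ 3 * ∫⁻ X : Fin n → EuclideanSpace ℝ (Fin 3), ((∑ k : Fin 3 → Fin m, (∫⁻ y in {y : EuclideanSpace ℝ (Fin 3) | ∀ i, y i ∈ Set.Ico ((k i : ℝ) * (L / m)) (((k i : ℝ) + 1) * (L / m))}, (‖Φ (Matrix.vecCons y X)‖₊ : ENNReal) ^ 2) ^ 2) / (∫⁻ y, (‖Φ (Matrix.vecCons y X)‖₊ : ENNReal) ^ 2)) ≤ ENNReal.ofReal C := by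
  intro hSq v hv
  obtain ⟨ρ₀, hρ₀, h⟩ := hSq v hv
  refine ⟨ρ₀, hρ₀, fun ρ hρ hρlt ℓ _hℓ => ?_⟩
  obtain ⟨C, hC⟩ := h ρ hρ hρlt
  refine ⟨C, ?_⟩
  filter_upwards [hC] with n hCn
  intro Φ hΦgs hΦpos
  have hL : 0 < BoseGas.sideLength ρ (n + 1) := by
    unfold BoseGas.sideLength
    exact Real.rpow_pos_of_pos (div_pos (Nat.cast_pos.2 (Nat.succ_pos n)) hρ) _
  dsimp only
  refine le_trans ?_ (hCn Φ hΦgs hΦpos)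
  set L := BoseGas.sideLength ρ (n + 1) with hLdef
  set m := ⌊L / ℓ⌋₊ with hmdef
  have hslice : ∀ X : Fin n → EuclideanSpace ℝ (Fin 3),
      Measurable fun y : BoseGas.Space => Φ (Matrix.vecCons y X) := fun X =>
    BoseGas.measurable_comp_vecCons_left hΦgs.measurable X
  have hm3 : (m : ℝ≥0∞) ^ 3 ≠ ⊤ := ENNReal.pow_ne_top (ENNReal.natCast_ne_top m)
  have hL3 : ENNReal.ofReal L ^ 3 ≠ ⊤ := ENNReal.pow_ne_top ENNReal.ofReal_ne_top
  rw [← lintegral_const_mul' _ _ hm3, ← lintegral_const_mul' _ _ hL3]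
  exact lintegral_mono fun X => coarse_div_le_sliceSq_div hL m (hslice X) _

/-- **The slice `L⁴/L²` bound implies the crux.** `E_μ̂[L³ ‖p_X̂‖₂²] ≤ C` on non-negative ground
states, eventually in `n`, for admissible `v` and small `ρ` (hypothesis as in
`groundStateBound_of_sliceSqBound`) gives `CoarseGrainedReverseHolder`
(`coarseGrainedReverseHolder_of_groundStates ∘ groundStateBound_of_sliceSqBound`). -/
theorem coarseGrainedReverseHolder_of_sliceSqBound : (∀ v : ℝ → ENNReal, BoseGas.IsRepulsiveFiniteRange v → ∃ ρ₀ : ℝ, 0 < ρ₀ ∧ ∀ ρ : ℝ, 0 < ρ → ρ < ρ₀ → ∃ C : ℝ, ∀ᶠ n : ℕ in Filter.atTop, ∀ Φ : BoseGas.Config (n + 1) → ℂ, BoseGas.IsGroundState v (BoseGas.sideLength ρ (n + 1)) Φ → (∀ X, Φ X = (‖Φ X‖ : ℂ)) → ENNReal.ofReal (BoseGas.sideLength ρ (n + 1)) ^ 3 * ∫⁻ X : Fin n → EuclideanSpace ℝ (Fin 3), (∫⁻ y, (‖Φ (Matrix.vecCons y X)‖₊ : ENNReal) ^ 4) / (∫⁻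 y, (‖Φ (Matrix.vecCons y X)‖₊ : ENNReal) ^ 2) ≤ ENNReal.ofReal C) → CoarseGrainedReverseHolder := fun hSq =>
  coarseGrainedReverseHolder_of_groundStates (groundStateBound_of_sliceSqBound hSq)

/-- **The maximal-slice bound implies the slice `L⁴/L²` bound.** If for every admissible `v` and all
small `ρ` there is `K` such that, eventually in `n`, every non-negative ground state `Φ` of `n + 1`
bosons in the Dirichlet box of side `L` satisfies `∫ dX̂ L³ · ess sup_y Φ(y,X̂)² ≤ K` (the `y`-supremum
of the slice in place of its `y`-integral, whose `dX̂`-integral is `1`), then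
`L³ ∫ dX̂ (∫ Φ(y,X̂)⁴ dy)/(∫ Φ(y,X̂)² dy) ≤ K` (`∫ Φ⁴ ≤ ess sup Φ² · ∫ Φ²` slice by slice and
`(s · M)/M ≤ s` in `[0,∞]`). -/
theorem sliceSqBound_of_essSupBound : (∀ v : ℝ → ENNReal, BoseGas.IsRepulsiveFiniteRange v → ∃ ρ₀ : ℝ, 0 < ρ₀ ∧ ∀ ρ : ℝ, 0 < ρ → ρ < ρ₀ → ∃ K : ℝ, ∀ᶠ n : ℕ in Filter.atTop, ∀ Φ : BoseGas.Config (n + 1) → ℂ, BoseGas.IsGroundState v (BoseGas.sideLength ρ (n + 1)) Φ → (∀ X, Φ X = (‖Φ X‖ : ℂ)) → ENNReal.ofReal (BoseGas.sideLength ρ (n + 1)) ^ 3 * ∫⁻ X : Fin n → EuclideanSpace ℝ (Fin 3), essSup (fun y => (‖Φ (Matrix.vecCons y X)‖₊ : ENNReal) ^ 2) volume ≤ ENNReal.ofReal K) → ∀ v : ℝ → ENNReal, BoseGas.IsRepulsiveFiniteRange v → ∃ ρ₀ : ℝ, 0 < ρ₀ ∧ ∀ ρ : ℝ, 0 < ρ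 → ρ < ρ₀ → ∃ C : ℝ, ∀ᶠ n : ℕ in Filter.atTop, ∀ Φ : BoseGas.Config (n + 1) → ℂ, BoseGas.IsGroundState v (BoseGas.sideLength ρ (n + 1)) Φ → (∀ X, Φ X = (‖Φ X‖ : ℂ)) → ENNReal.ofReal (BoseGas.sideLength ρ (n + 1)) ^ 3 * ∫⁻ X : Fin n → EuclideanSpace ℝ (Fin 3), (∫⁻ y, (‖Φ (Matrix.vecCons y X)‖₊ : ENNReal) ^ 4) / (∫⁻ y, (‖Φ (Matrix.vecCons y X)‖₊ : ENNReal) ^ 2) ≤ ENNReal.ofReal C := by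
  intro hSup v hv
  obtain ⟨ρ₀, hρ₀, h⟩ := hSup v hv
  refine ⟨ρ₀, hρ₀, fun ρ hρ hρlt => ?_⟩
  obtain ⟨K, hK⟩ := h ρ hρ hρlt
  refine ⟨K, ?_⟩
  filter_upwards [hK] with n hKn
  intro Φ hΦgs hΦpos
  refine le_trans ?_ (hKn Φ hΦgs hΦpos)
  gcongr with X
  have hslice : Measurable fun y : BoseGas.Space => Φ (Matrix.vecCons y X) :=
    BoseGas.measurable_comp_vecCons_left hΦgs.measurable X
  calc (∫⁻ y, (‖Φ (Matrix.vecCons y X)‖₊ : ℝ≥0∞) ^ 4) /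
        (∫⁻ y, (‖Φ (Matrix.vecCons y X)‖₊ : ℝ≥0∞) ^ 2)
      ≤ (essSup (fun y => (‖Φ (Matrix.vecCons y X)‖₊ : ℝ≥0∞) ^ 2) volume *
            ∫⁻ y, (‖Φ (Matrix.vecCons y X)‖₊ : ℝ≥0∞) ^ 2) /
          (∫⁻ y, (‖Φ (Matrix.vecCons y X)‖₊ : ℝ≥0∞) ^ 2) :=
        ENNReal.div_le_div_right (lintegral_pow_four_le_essSup_mul hslice) _
    _ = essSup (fun y => (‖Φ (Matrix.vecCons y X)‖₊ : ℝ≥0∞) ^ 2) volume *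
          ((∫⁻ y, (‖Φ (Matrix.vecCons y X)‖₊ : ℝ≥0∞) ^ 2) /
            ∫⁻ y, (‖Φ (Matrix.vecCons y X)‖₊ : ℝ≥0∞) ^ 2) := mul_div_assoc _ _ _
    _ ≤ essSup (fun y => (‖Φ (Matrix.vecCons y X)‖₊ : ℝ≥0∞) ^ 2) volume * 1 := by
        gcongr
        exact ENNReal.div_self_le_one
    _ = essSup (fun y => (‖Φ (Matrix.vecCons y X)‖₊ : ℝ≥0∞) ^ 2) volume := mul_one _

/-- **The maximal-slice bound implies the crux**: `∫ dX̂ L³ ess sup_y Φ(y,X̂)² ≤ K` on non-negative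
ground states, eventually in `n`, for admissible `v` and small `ρ`, gives `CoarseGrainedReverseHolder`
(`coarseGrainedReverseHolder_of_sliceSqBound ∘ sliceSqBound_of_essSupBound`). -/
theorem coarseGrainedReverseHolder_of_essSupBound : (∀ v : ℝ → ENNReal, BoseGas.IsRepulsiveFiniteRange v → ∃ ρ₀ : ℝ, 0 < ρ₀ ∧ ∀ ρ : ℝ, 0 < ρ → ρ < ρ₀ → ∃ K : ℝ, ∀ᶠ n : ℕ in Filter.atTop, ∀ Φ : BoseGas.Config (n + 1) → ℂ, BoseGas.IsGroundState v (BoseGas.sideLength ρ (n + 1)) Φ → (∀ X, Φ X = (‖Φ X‖ : ℂ)) → ENNReal.ofReal (BoseGas.sideLength ρ (n + 1)) ^ 3 * ∫⁻ X : Fin n → EuclideanSpace ℝ (Fin 3), essSup (fun y => (‖Φ (Matrix.vecCons y X)‖₊ : ENNReal) ^ 2) volume ≤ ENNReal.ofReal K) → CoarseGrainedReverseHolder := fun hSup =>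
  coarseGrainedReverseHolder_of_sliceSqBound (sliceSqBound_of_essSupBound hSup)

end Summit.AtomisticToContinuum.BoseEinsteinCondensation.Theorems.CoarseGrainedReverseHolder

end
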